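import Mathlib
import Summits.ValiantsHypothesis.ValiantsHypothesis.Theorems.LacunarySymmetroidMatrixDescartesDetLorentzianNonneg
import Summits.ValiantsHypothesis.ValiantsHypothesis.Theorems.LacunarySymmetroidMatrixDescartesDetLorentzianSupportMConvex
import Summits.ValiantsHypothesis.ValiantsHypothesis.Theorems.LacunarySymmetroidMatrixDescartesDetLorentzianLimit

/-!
# ValiantsHypothesis / LacunarySymmetroid — crux `MatrixDescartes` (stmt-ValiantsHypothesis-18050), line
# `Cruxes/MatrixDescartes/Lines/lorentzian_shadow.lean` :: **`stub_detLorentzian` (`DetLorentzian`) — ASSEMBLED**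

Helper file (`--supports stmt-ValiantsHypothesis-18050 --as helper`; cell val-lit, seat val-lit-p5 g9 = the ONE writer
named by merged desk RULINGS #95/#98 [L5]).  Closes NO ledger item (the line is unregistered; planner debt: import
this file and close the skeleton's `stub_detLorentzian` by `exact DetLorentzianAssembly.isLorentzianArray_detArray_of_posSemidef`
— the statement below is `DetLorentzian` with `IsLorentzianArray`, `detArray`, `layer`, `exch`, `IsMConvexOn`,
`factWeight`, `hessAt`, `AtMostOnePosEig` unfolded VERBATIM; `Iff.rfl` against a copy of the line's definitions was
checked in the seat's scratch `work/dl/DefeqScratch.lean`).  «V1 line lemma (KNOWN mathematics: Borcea–Brändén /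
Brändén–Huh / Gårding for PSD determinantal pencils); the line's LAW `stub_lorentzianDescartes`, `MatrixDescartes`,
Conjecture B and `VP ≠ VNP` remain OPEN and are NOT moved.»

**`isLorentzianArray_detArray_of_posSemidef`**: for positive semidefinite real symmetric `A_0, …, A_{K-1}` of size
`m`, the coefficient array `c_α = [s^α] det (Σ_l s_l A_l)` is a LORENTZIAN ARRAY: (a) `c ≥ 0` and (b) `c` vanishes off
the layer `|α| = m` — p7 g10, `DetLorentzian.detArray_nonneg_of_posSemidef` / `detArray_eq_zero_of_not_mem_layer`
(p591936); (c) the support is M-convex — p7 g10, `DetLorentzian.detArray_support_isMConvexOn` (p593319; Rado /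
polymatroid exchange); (d) every Hessian block `hessAt c γ`, `|γ| = m − 2`, has at most one positive eigenvalue —
p4 g10 / p6 g12 for definite tuples (`DetLorentzianHessianDefinite.atMostOnePosEig_hessAt_detArray_of_posDef`,
Gårding–Rolle over the tree's hyperbolic-polynomial library) and this seat's semidefinite limit
(`DetLorentzianLimit.atMostOnePosEig_hessAt_detArray_of_posSemidef`).
-/

set_option linter.dupNamespace false

namespace Summit.ValiantsHypothesis.ValiantsHypothesis.Theorems.LacunarySymmetroidMatrixDescartes

open Matrix

namespace DetLorentzianAssembly

/-- **`DetLorentzian` (line `lorentzian_shadow`, stub `stub_detLorentzian`), statement unfolded verbatim**: the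
coefficient array of `det (Σ_l s_l A_l)` for positive semidefinite `A_l` is a Lorentzian array — nonnegative,
supported on the layer `|α| = m`, with M-convex support, and with every `(m−2)`-nd Hessian block of Lorentz
signature. [Borcea–Brändén 2009 Prop. 2.4; Brändén–Huh 2020 §2; Gårding 1959] -/
theorem isLorentzianArray_detArray_of_posSemidef :
    ∀ (m K : ℕ) (A : Fin K → Matrix (Fin m) (Fin m) ℝ), (∀ l, (A l).PosSemidef) →
      (∀ α : Fin K → ℕ, 0 ≤ MvPolynomial.coeff (Finsupp.equivFunOnFinite.symm α)
          (Matrix.det (∑ l, (MvPolynomial.X l : MvPolynomial (Fin K) ℝ) • (A l).map MvPolynomial.C))) ∧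
      (∀ α : Fin K → ℕ, α ∉ ((Fintype.piFinset fun _ : Fin K => Finset.range (m + 1)).filter (fun α => ∑ i, α i = m)) →
        MvPolynomial.coeff (Finsupp.equivFunOnFinite.symm α)
          (Matrix.det (∑ l, (MvPolynomial.X l : MvPolynomial (Fin K) ℝ) • (A l).map MvPolynomial.C)) = 0) ∧
      (∀ α ∈ (((Fintype.piFinset fun _ : Fin K => Finset.range (m + 1)).filter (fun α => ∑ i, α i = m)).filter
        (fun α => MvPolynomial.coeff (Finsupp.equivFunOnFinite.symm α)
          (Matrix.det (∑ l, (MvPolynomial.X l : MvPolynomial (Fin K) ℝ) • (A l).map MvPolynomial.C)) ≠ 0)),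
        ∀ β ∈ (((Fintype.piFinset fun _ : Fin K => Finset.range (m + 1)).filter (fun α => ∑ i, α i = m)).filter
        (fun α => MvPolynomial.coeff (Finsupp.equivFunOnFinite.symm α)
          (Matrix.det (∑ l, (MvPolynomial.X l : MvPolynomial (Fin K) ℝ) • (A l).map MvPolynomial.C)) ≠ 0)),
        ∀ i : Fin K, β i < α i →
          ∃ j : Fin K, α j < β j ∧
            (α - Pi.single i 1 + Pi.single j 1) ∈ (((Fintype.piFinset fun _ : Fin K => Finset.range (m + 1)).filter (fun α => ∑ i, α i = m)).filter
        (fun α => MvPolynomial.coeff (Finsupp.equivFunOnFinite.symm α)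
          (Matrix.det (∑ l, (MvPolynomial.X l : MvPolynomial (Fin K) ℝ) • (A l).map MvPolynomial.C)) ≠ 0)) ∧
            (β - Pi.single j 1 + Pi.single i 1) ∈ (((Fintype.piFinset fun _ : Fin K => Finset.range (m + 1)).filter (fun α => ∑ i, α i = m)).filter
        (fun α => MvPolynomial.coeff (Finsupp.equivFunOnFinite.symm α)
          (Matrix.det (∑ l, (MvPolynomial.X l : MvPolynomial (Fin K) ℝ) • (A l).map MvPolynomial.C)) ≠ 0)) ∧
            (fun _ : Fin K → ℕ => (0 : ℚ)) (α - Pi.single i 1 + Pi.single j 1) +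
                (fun _ : Fin K → ℕ => (0 : ℚ)) (β - Pi.single j 1 + Pi.single i 1) ≤
              (fun _ : Fin K → ℕ => (0 : ℚ)) α + (fun _ : Fin K → ℕ => (0 : ℚ)) β) ∧
      (∀ γ ∈ (Fintype.piFinset fun _ : Fin K => Finset.range (m - 2 + 1)).filter (fun α => ∑ i, α i = m - 2),
        ∀ v w : Fin K → ℝ,
          0 < v ⬝ᵥ ((fun i j : Fin K =>
                ((∏ k, ((γ + Pi.single i 1 + Pi.single j 1 : Fin K → ℕ) k).factorial : ℕ) : ℝ) *
                  MvPolynomial.coeff (Finsupp.equivFunOnFinite.symm (γ + Pi.single i 1 + Pi.single j 1))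
          (Matrix.det (∑ l, (MvPolynomial.X l : MvPolynomial (Fin K) ℝ) • (A l).map MvPolynomial.C)))
              *ᵥ v) →
            (v ⬝ᵥ ((fun i j : Fin K =>
                ((∏ k, ((γ + Pi.single i 1 + Pi.single j 1 : Fin K → ℕ) k).factorial : ℕ) : ℝ) *
                  MvPolynomial.coeff (Finsupp.equivFunOnFinite.symm (γ + Pi.single i 1 + Pi.single j 1))
          (Matrix.det (∑ l, (MvPolynomial.X l : MvPolynomial (Fin K) ℝ) • (A l).map MvPolynomial.C)))
              *ᵥ v)) *
              (w ⬝ᵥ ((fun i j : Fin K =>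
                ((∏ k, ((γ + Pi.single i 1 + Pi.single j 1 : Fin K → ℕ) k).factorial : ℕ) : ℝ) *
                  MvPolynomial.coeff (Finsupp.equivFunOnFinite.symm (γ + Pi.single i 1 + Pi.single j 1))
          (Matrix.det (∑ l, (MvPolynomial.X l : MvPolynomial (Fin K) ℝ) • (A l).map MvPolynomial.C)))
              *ᵥ w)) ≤
            (v ⬝ᵥ ((fun i j : Fin K =>
                ((∏ k, ((γ + Pi.single i 1 + Pi.single j 1 : Fin K → ℕ) k).factorial : ℕ) : ℝ) *
                  MvPolynomial.coeff (Finsupp.equivFunOnFinite.symm (γ + Pi.single i 1 + Pi.single j 1))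
          (Matrix.det (∑ l, (MvPolynomial.X l : MvPolynomial (Fin K) ℝ) • (A l).map MvPolynomial.C)))
              *ᵥ w)) ^ 2) :=
  fun m K A hA =>
    ⟨DetLorentzian.detArray_nonneg_of_posSemidef m K A hA,
      fun α hα => DetLorentzian.detArray_eq_zero_of_not_mem_layer m K A α hα,
      DetLorentzian.detArray_support_isMConvexOn m K A hA,
      DetLorentzianLimit.atMostOnePosEig_hessAt_detArray_of_posSemidef m K A hA⟩

end DetLorentzianAssembly

end Summit.ValiantsHypothesis.ValiantsHypothesis.Theorems.LacunarySymmetroidMatrixDescartes
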